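import Mathlib.Analysis.Complex.Liouville
import Mathlib.Analysis.SpecialFunctions.Exponential
import Mathlib.Analysis.Calculus.Deriv.Mul
import Mathlib.Analysis.Calculus.IteratedDeriv.Defs

/-!
# `Balaban1983to89.B9Eq3101CommutatorCauchyBlockDecay` — T. Bałaban, *Propagators for lattice gauge theories in a background field*, Commun. Math.
# Phys. **99** (1985) 389–434 [Balaban1985BackgroundPropagators] (3.101) p. 414 over (3.49) p. 399: **FROM ONE UNIFORM BOUND ON THE CONJUGATES
# `e^{κχ_E} T e^{−κχ_S}` TO EVERY COMMUTATOR SIZE AND TO BLOCK DECAY — `‖adⁿ T‖ ≤ n!·C∕κ₀ⁿ` (two-space Cauchy estimate; `‖[χ,T]‖ ≤ C∕κ₀`,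
# `‖[χ,[χ,T]]‖ ≤ 2C·(g∕(κ₁M))²` at the radius `κ₀ = κ₁M∕g`) AND `‖q T p‖ ≤ e^{−κ₀|b − a|}·‖q‖·C·‖p‖` for a weight constant (`a`, `b`) on the two
# blocks (ONE real conjugation bound, no analyticity)** — route R2′ STEP B8′ of the pub-balaban NE9 chain, the S-P5(b) → S-P7 glue, the `ℂ` sections

statement-level skeleton of published theorems with citation tags; proofs where landed; nothing here is a claim about the Yang–Mills mass gap

CITATION HEADER (lean-in-tree rule).  Audit cell `pub-balaban`, sub-cell `t4`, BINDER row NE9; filed by NE9 formalisation-swarm LEAF PROVER 01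
(`b2b-balaban-t4-ne9-formalise-leaf-01`, gen 80) as the PORT of the NE9 crux-ideation seat's abstract kernel
`t4/ideate/NE9/lens1-NE9TwoSpaceCauchyBlockSchur.lean` §0–§2 (t4-ne9-idea-1 gen 86, sha16 15b376350ba30591; scratch, never proposed — CREDIT: every
statement and proof idea below is that kernel's; new is only the dress: `def`-free, the two-space commutator and the conjugation family are LETTERS
`ad`, `F` with their defining equations `ad T = χ_E ∘ T − T ∘ χ_S`, `F T κ = e^{κχ_E} ∘ T ∘ e^{κ(−χ_S)}` as hypotheses (a consumer instantiates them
by `fun … => rfl`), and the headline corollaries are ALSO given letter-free), offered for `t4/ROUTES-NE9.md` v13.23 (v) «the abstract §0–§5 are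
fileable statement-first TODAY» (first refusal the row OWNER t4-ne9-p1, second this lineage; nobody's INTENT from journal l.46396 to this seat's
ONLINE l.47879).  Companion file (same port, the `𝕜`-general sections §3–§5 of the kernel): `B9Eq3101DoubleCommutatorBlockSchur` (block Schur test,
near-constant-cutoff localisation, the volume-free `(4N)²W_rW_c` assembly) — it consumes this file's outputs as LETTERS `τ_{BA}` and is import-independent.
Source READ in the held text (`paper:balaban1985-cmp99-background-propagators`, journal page = PDF page + 388): p. 414 (3.101)–(3.104), p. 399 (3.49),
p. 398 Thm 3.2 (3.48), p. 403 (3.65)–(3.68), p. 415.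

THE PRINT (verbatim).  p. 399 (3.49): *«For the operator P = I − R we obtain, using again Lemma 2.1, [|P(x, x′)|, |(DP)_μ(x, x′)|, |(PD*)_ν(x, x′)|,
|(DPD*)_{μν}(x, x′)|] ≤ O(1)[…]e^{−δ₀d(y,y′)} for x ∈ Δ(y), y ∈ Λ_j, x′ ∈ Δ(y′), y′ ∈ Λ_{j′}.»*  p. 414 (3.101): *«The operator P₁(∂h) satisfies the
inequalities (3.49) with the additional small factor O(M⁻¹) coming from an estimate of the expression (∂h)(Γ_{x,x′}) together with the exponential
decay of DPD*.»*  Print PROVES (3.49) by generalized random-walk expansions (p. 399 *«we will prove the above theorems by constructing generalized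
random walk expansions»*, p. 415 *«we replace the operator P by its random walk expansion … P = G′Q′*(Q′G′²Q′*)⁻¹Q′G′»*) and its analyticity
statements (Thm 3.4 p. 400, (3.65)–(3.68) p. 403) are in the GAUGE FIELD, not in a conjugation parameter; NOTHING of that is asserted here — the
Combes–Thomas∕Agmon conjugation and Cauchy's estimate below are the route's SUBSTITUTE for the random-walk road ([folklore]).  IN THE TREE ALREADY: print's ALGEBRA of (3.100)–(3.106) — the covariant Leibniz rule, the two-space kernel
identity behind (3.101)∕(3.102), (3.103)–(3.105) as exact identities — is typed at kernel level by the paper sub-cell b09 in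
`B9Eq3105Sum` (pure algebra, no estimate); THIS file is the ESTIMATE side of the same sentence in operator-norm currency and shares no
declaration with it.

WHY (route R2′ STEP B8′, the S-P5(b) → S-P7 glue, ROUTES-NE9 v13.21 (iii)(d) ∕ v13.23).  S-P5(b) delivers ONE bound
`sup_{|κ| ≤ κ₀} ‖e^{κχ}(DP)e^{−κχ}‖ ≤ c_DP` (ne9-leaf-06's `B9Eq349ConjugatedProjection.norm_conjDP_le_two`, fed by ne9-leaf-05's (I4) letters
`B9Eq3101ConjugationLetters` and the kernel-4 structure `B9Eq324ConjugatedFormDifference` — by name, at the lattice instance; NOT imported here);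
this file turns it into (a) every commutator size at once (`DP : L²(sites) → L²(bonds)` lives between TWO spaces, so the family is
`e^{κχ_E} ∘ T ∘ e^{−κχ_S}` and its derivative is the conjugate of the TWO-SPACE commutator `χ_E T − T χ_S`), (b) block decay from the real points `±κ₀`.
HONEST LIMIT (displayed, not argued): Cauchy turns a UNIFORM bound on the circle `‖κ‖ = κ₀` into commutator SIZE `C∕κ₀` — it creates no smallness;
the smallness is the RADIUS `κ₀ = κ₁M∕‖∇χ₀‖_∞` = decay rate × cutoff scale (`norm_ad_ad_le_of_radius` displays the `1∕M²`).

WHAT IS PROVED (sorry-free; proof lane — no `def`, no `Prop` placeholder; [folklore] over `ℂ`, Banach carriers `S`, `E`; nothing of [B9] asserted).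
* §0 the letter `ad` (`had : ∀ T, ad T = χ_E ∘L T − T ∘L χ_S`): `ad_apply_of_letter`, `norm_ad_le_crude` (`‖ad T‖ ≤ (‖χ_E‖ + ‖χ_S‖)‖T‖` — no smallness;
  what Cauchy improves on).
* §1a CAUCHY FOR ANY ENTIRE DRESSING FAMILY (any Banach `X`, any `ad : X → X`, `F : X → ℂ → X` with `F T 0 = T` and `HasDerivAt (F T) (F (ad T) κ) κ`):
  `iteratedDeriv_eq_of_hasDerivAt`, **`norm_iterate_le_of_hasDerivAt`** (`‖ad^[n] T‖ ≤ n!·C∕κ₀ⁿ` from ONE circle bound), `norm_ad_le_of_hasDerivAt`,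
  `norm_ad_ad_le_of_hasDerivAt` — the abstraction a lattice instance may feed with a pointwise `e^{κχ}` family, proving only its derivative.
* §1 TWO-SPACE CAUCHY (letters `ad`, `F`, `hF : ∀ T κ, F T κ = exp(κ•χ_E) ∘L T ∘L exp(κ•(−χ_S))`): `F_zero_of_letter` (`F T 0 = T`),
  **`hasDerivAt_F_of_letter`** (`HasDerivAt (F T) (F (ad T) κ) κ` — Mathlib's `hasDerivAt_exp_smul_const(')` on both factors; the two cross terms
  recombine into the conjugate of `ad T` because `e^{κχ}` commutes with `χ`), `deriv_F_of_letter`, `differentiable_F_of_letter`,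
  **`iteratedDeriv_F_of_letter`** (`iteratedDeriv n (F T) = F (ad^[n] T)`), **`norm_iterate_ad_le`** (`0 < κ₀`, `∀ κ, ‖κ‖ = κ₀ → ‖F T κ‖ ≤ C` ⇒
  `‖ad^[n] T‖ ≤ n!·C∕κ₀ⁿ` — Mathlib's `Complex.norm_iteratedDeriv_le_of_forall_mem_sphere_norm_le` for the entire `F T`, read at `κ = 0`),
  `norm_ad_le` (`≤ C∕κ₀`), `norm_ad_ad_le` (`≤ 2C∕κ₀²`), **`norm_ad_ad_le_of_radius`** (`0 < κ₁, M, g`, bound on `‖κ‖ = κ₁M∕g` ⇒ `≤ 2C·(g∕(κ₁M))²`);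
  LETTER-FREE corollaries **`norm_comm_le_of_circle_bound`** (`‖χ_E ∘L T − T ∘L χ_S‖ ≤ C∕κ₀`) and **`norm_comm_comm_le_of_circle_bound`**.
* §2 BLOCK DECAY (no analyticity): in a Banach algebra `x·p = a•p ⇒ exp x · p = e^a • p` (`exp_mul_eq_smul_of_mul_eq_smul`, termwise on the series;
  mirror `mul_exp_eq_smul_of_mul_eq_smul`); **`block_eq_smul_block_conj`** (`χ_S ∘ p = a•p`, `q ∘ χ_E = b•q` ⇒ `q T p = e^{−κ(b−a)} • (q ∘ F(κ) ∘ p)`,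
  explicit); **`norm_block_le_of_conj_bound`** (real `a b κ₀`, ONE bound `‖e^{κ₀χ_E} T e^{κ₀(−χ_S)}‖ ≤ C` ⇒ `‖q T p‖ ≤ e^{−κ₀(b−a)}·‖q‖·C·‖p‖`);
  **`norm_block_le_of_conj_bound_abs`** (bounds at `±κ₀` ⇒ `e^{−κ₀|b−a|}`) — the weight need only be CONSTANT ON THE TWO BLOCKS.  §3 non-vacuity.
DICTIONARY for the lattice instance (words; nothing lattice is asserted): `T = DP`, `χ_S`, `χ_E` = multiplication by `χ = χ₀(·∕M)` on sites ∕ bonds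
(`g = ‖∇χ₀‖_∞`), `C = c_DP`, radius `κ₀ = κ₁M∕g` from S-P5(b)(c); for decay between unit cubes `A` (sites) and `B` (bonds): the pair-adapted weight
`χ^{(A,B)}` = distance to `A` truncated at `dist(A,B)` (`a = 0`, `b = dist(A,B) − O(1)`), real `κ = ±κ₁`, giving the companion file's letter
`τ_{BA} = c_DP·e^{−κ₁(dist(A,B) − 2)₊}`.
HONEST SCOPE.  Symbolic; no lattice, no decay rate, no `c_DP`; ONE input of ONE sub-step of a route step, NOT NE9 (cell pub-balaban: NE9 NOT PRINTED ∕
NOT PROVED; «NE9 ⇐ the named binders»; spine PROVED 0∕9; rung (B)+1 on a finite T⁴ — NOT infinite volume, NOT mass gap, NOT Clay; HONEST DEPENDENCY: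
continuum YM on T⁴ ⇐ BetaPertH ∧ nine spine estimates (0/9 proved); BetaPertH ⇐ (D1) ∧ (D4) ∧ CAP+tail; G-an2-4 gates asym, D1 and NE2/3/4).  NEW file,
Mathlib-only imports; nothing modified.  Net new unproved facts: 0.
-/

namespace Literature.MathematicalPhysics.QuantumFieldTheory.Balaban1983to89.B9Eq3101CommutatorCauchyBlockDecay

open NormedSpace Metric ContinuousLinearMap
open scoped BigOperators

/-! ## §0 The two-space commutator as a letter -/

section Ad

variable {𝕜 : Type*} [NontriviallyNormedField 𝕜]
  {S E : Type*} [NormedAddCommGroup S] [NormedSpace 𝕜 S] [NormedAddCommGroup E] [NormedSpace 𝕜 E]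

/-- the letter unfolded at a point: `ad T x = χ_E (T x) − T (χ_S x)`. [folklore] [cite: Balaban1985BackgroundPropagators, (3.101) p.414] -/
theorem ad_apply_of_letter {χE : E →L[𝕜] E} {χS : S →L[𝕜] S} {ad : (S →L[𝕜] E) → (S →L[𝕜] E)}
    (had : ∀ T, ad T = χE ∘L T - T ∘L χS) (T : S →L[𝕜] E) (x : S) : ad T x = χE (T x) - T (χS x) := by
  rw [had]; rfl

/-- the crude bound `‖ad T‖ ≤ (‖χ_E‖ + ‖χ_S‖)‖T‖` — no smallness; this is what Cauchy improves on when a conjugation bound is known. [folklore]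
[cite: Balaban1985BackgroundPropagators, (3.101) p.414] -/
theorem norm_ad_le_crude {χE : E →L[𝕜] E} {χS : S →L[𝕜] S} {ad : (S →L[𝕜] E) → (S →L[𝕜] E)}
    (had : ∀ T, ad T = χE ∘L T - T ∘L χS) (T : S →L[𝕜] E) : ‖ad T‖ ≤ (‖χE‖ + ‖χS‖) * ‖T‖ := by
  rw [had]
  refine (norm_sub_le _ _).trans ?_
  have h1 := opNorm_comp_le χE T
  have h2 := opNorm_comp_le T χS
  nlinarith [norm_nonneg χE, norm_nonneg χS, norm_nonneg T]

end Ad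

/-! ## §1a Cauchy's estimate for ANY entire dressing family (the abstraction a lattice instance may prefer) -/

section AnyDressing

variable {X : Type*} [NormedAddCommGroup X] [NormedSpace ℂ X] [CompleteSpace X] {ad : X → X} {F : X → ℂ → X}

omit [CompleteSpace X] in
/-- If every `F T` has derivative `F (ad T)`, then `(F T)⁽ⁿ⁾ = F (adⁿ T)` — for ANY Banach space `X` of «operators», any self-map `ad` and any
dressing family `F` (no exponential is named). [folklore] [cite: Balaban1985BackgroundPropagators, (3.101) p.414] -/
theorem iteratedDeriv_eq_of_hasDerivAt (hderiv : ∀ T κ, HasDerivAt (F T) (F (ad T) κ) κ) (n : ℕ) :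
    ∀ T : X, iteratedDeriv n (F T) = F (ad^[n] T) := by
  induction n with
  | zero => intro T; simp [iteratedDeriv_zero]
  | succ n ih =>
      intro T
      rw [iteratedDeriv_succ', show deriv (F T) = F (ad T) from funext fun κ => (hderiv T κ).deriv, ih,
        Function.iterate_succ_apply]

/-- **CAUCHY's ESTIMATE FOR AN ENTIRE DRESSING FAMILY**: `F T 0 = T`, `(F T)′ = F (ad T)` everywhere, and ONE circle bound
`∀ κ, ‖κ‖ = κ₀ → ‖F T κ‖ ≤ C` ⇒ `‖adⁿ T‖ ≤ n!·C∕κ₀ⁿ`.  The `exp`-conjugation family of §1 is one instance; a lattice consumer may feed the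
pointwise family `κ ↦ (f ↦ e^{κχ}·T(e^{−κχ}f))` directly, proving only its derivative. [folklore] (Cauchy's estimate, Banach-valued)
[cite: Balaban1985BackgroundPropagators, (3.101) p.414 «small factor O(M⁻¹)», (3.49) p.399] -/
theorem norm_iterate_le_of_hasDerivAt (hF0 : ∀ T, F T 0 = T) (hderiv : ∀ T κ, HasDerivAt (F T) (F (ad T) κ) κ) (T : X) (n : ℕ)
    {κ₀ C : ℝ} (hκ₀ : 0 < κ₀) (hC : ∀ κ : ℂ, ‖κ‖ = κ₀ → ‖F T κ‖ ≤ C) :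
    ‖ad^[n] T‖ ≤ n.factorial * C / κ₀ ^ n := by
  have hdiff : Differentiable ℂ (F T) := fun κ => (hderiv T κ).differentiableAt
  have h := Complex.norm_iteratedDeriv_le_of_forall_mem_sphere_norm_le (c := 0) n hκ₀ hdiff.diffContOnCl
    (fun z hz => hC z (mem_sphere_zero_iff_norm.mp hz))
  rwa [iteratedDeriv_eq_of_hasDerivAt hderiv, hF0] at h

/-- … `n = 1`: `‖ad T‖ ≤ C∕κ₀`. [folklore] (Cauchy's estimate) [cite: Balaban1985BackgroundPropagators, (3.101) p.414] -/
theorem norm_ad_le_of_hasDerivAt (hF0 : ∀ T, F T 0 = T) (hderiv : ∀ T κ, HasDerivAt (F T) (F (ad T) κ) κ) (T : X)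
    {κ₀ C : ℝ} (hκ₀ : 0 < κ₀) (hC : ∀ κ : ℂ, ‖κ‖ = κ₀ → ‖F T κ‖ ≤ C) : ‖ad T‖ ≤ C / κ₀ := by
  simpa using norm_iterate_le_of_hasDerivAt hF0 hderiv T 1 hκ₀ hC

/-- … `n = 2`: `‖ad (ad T)‖ ≤ 2C∕κ₀²`. [folklore] (Cauchy's estimate) [cite: Balaban1985BackgroundPropagators, (3.101) p.414, (3.104) p.414] -/
theorem norm_ad_ad_le_of_hasDerivAt (hF0 : ∀ T, F T 0 = T) (hderiv : ∀ T κ, HasDerivAt (F T) (F (ad T) κ) κ) (T : X)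
    {κ₀ C : ℝ} (hκ₀ : 0 < κ₀) (hC : ∀ κ : ℂ, ‖κ‖ = κ₀ → ‖F T κ‖ ≤ C) : ‖ad (ad T)‖ ≤ 2 * C / κ₀ ^ 2 := by
  simpa [Nat.factorial] using norm_iterate_le_of_hasDerivAt hF0 hderiv T 2 hκ₀ hC

end AnyDressing

/-! ## §1 The two-space conjugation family and Cauchy's estimate -/

section Cauchy

variable {S E : Type*} [NormedAddCommGroup S] [NormedSpace ℂ S] [NormedAddCommGroup E] [NormedSpace ℂ E]
  {χE : E →L[ℂ] E} {χS : S →L[ℂ] S} {ad : (S →L[ℂ] E) → (S →L[ℂ] E)} {F : (S →L[ℂ] E) → ℂ → (S →L[ℂ] E)}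

/-- `F T 0 = T`. [folklore] [cite: Balaban1985BackgroundPropagators, (3.49) p.399] -/
theorem F_zero_of_letter (hF : ∀ T κ, F T κ = exp (κ • χE) ∘L T ∘L exp (κ • (-χS))) (T : S →L[ℂ] E) : F T 0 = T := by
  simp [hF, exp_zero, one_def]

variable [CompleteSpace S] [CompleteSpace E]

/-- **`(F T)′(κ) = F (ad T) κ`**: the derivative of the conjugation family is the conjugation family of the two-space commutator. [folklore]
(Combes–Thomas ∕ Agmon conjugation) [cite: Balaban1985BackgroundPropagators, (3.101) p.414, (3.49) p.399] -/
theorem hasDerivAt_F_of_letter (had : ∀ T, ad T = χE ∘L T - T ∘L χS)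
    (hF : ∀ T κ, F T κ = exp (κ • χE) ∘L T ∘L exp (κ • (-χS))) (T : S →L[ℂ] E) (κ : ℂ) :
    HasDerivAt (F T) (F (ad T) κ) κ := by
  have hE := hasDerivAt_exp_smul_const (𝕂 := ℂ) χE κ
  have hS := hasDerivAt_exp_smul_const' (𝕂 := ℂ) (-χS) κ
  have hT : HasDerivAt (fun _ : ℂ => T) (0 : S →L[ℂ] E) κ := hasDerivAt_const κ T
  have h := hE.clm_comp (hT.clm_comp hS)
  have hfun : F T = fun κ => exp (κ • χE) ∘L (T ∘L exp (κ • (-χS))) := by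
    funext κ; rw [hF]
  rw [hfun]
  refine h.congr_deriv ?_
  rw [mul_def, mul_def, hF, had]
  ext x
  simp only [add_apply, comp_apply, zero_apply, zero_add, sub_apply, map_sub, neg_apply, map_neg]
  abel

/-- `deriv (F T) = F (ad T)`. [folklore] [cite: Balaban1985BackgroundPropagators, (3.101) p.414] -/
theorem deriv_F_of_letter (had : ∀ T, ad T = χE ∘L T - T ∘L χS)
    (hF : ∀ T κ, F T κ = exp (κ • χE) ∘L T ∘L exp (κ • (-χS))) (T : S →L[ℂ] E) :
    deriv (F T) = F (ad T) :=
  funext fun κ => (hasDerivAt_F_of_letter had hF T κ).deriv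

/-- `F T` is entire. [folklore] [cite: Balaban1985BackgroundPropagators, (3.49) p.399, (3.65)–(3.68) p.403] -/
theorem differentiable_F_of_letter (had : ∀ T, ad T = χE ∘L T - T ∘L χS)
    (hF : ∀ T κ, F T κ = exp (κ • χE) ∘L T ∘L exp (κ • (-χS))) (T : S →L[ℂ] E) :
    Differentiable ℂ (F T) :=
  fun κ => (hasDerivAt_F_of_letter had hF T κ).differentiableAt

/-- **`(F T)⁽ⁿ⁾ = F (adⁿ T)`**. [folklore] [cite: Balaban1985BackgroundPropagators, (3.101) p.414] -/
theorem iteratedDeriv_F_of_letter (had : ∀ T, ad T = χE ∘L T - T ∘L χS)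
    (hF : ∀ T κ, F T κ = exp (κ • χE) ∘L T ∘L exp (κ • (-χS))) (n : ℕ) :
    ∀ T : S →L[ℂ] E, iteratedDeriv n (F T) = F (ad^[n] T) := by
  induction n with
  | zero => intro T; simp [iteratedDeriv_zero]
  | succ n ih => intro T; rw [iteratedDeriv_succ', deriv_F_of_letter had hF, ih, Function.iterate_succ_apply]

/-- **THE TWO-SPACE CAUCHY ESTIMATE.** ONE circle bound on the conjugation family controls every iterated commutator:
`sup_{‖κ‖ = κ₀} ‖e^{κχ_E} T e^{−κχ_S}‖ ≤ C` ⟹ `‖adⁿ T‖ ≤ n!·C∕κ₀ⁿ`. [folklore] (Cauchy's estimate, Banach-valued)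
[cite: Balaban1985BackgroundPropagators, (3.101) p.414 «small factor O(M⁻¹)», (3.49) p.399] -/
theorem norm_iterate_ad_le (had : ∀ T, ad T = χE ∘L T - T ∘L χS)
    (hF : ∀ T κ, F T κ = exp (κ • χE) ∘L T ∘L exp (κ • (-χS))) (T : S →L[ℂ] E) (n : ℕ) {κ₀ C : ℝ} (hκ₀ : 0 < κ₀)
    (hC : ∀ κ : ℂ, ‖κ‖ = κ₀ → ‖F T κ‖ ≤ C) :
    ‖ad^[n] T‖ ≤ n.factorial * C / κ₀ ^ n :=
  norm_iterate_le_of_hasDerivAt (F_zero_of_letter hF) (hasDerivAt_F_of_letter had hF) T n hκ₀ hC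

/-- `‖[χ, T]‖ ≤ C∕κ₀`. [folklore] (Cauchy's estimate) [cite: Balaban1985BackgroundPropagators, (3.101) p.414] -/
theorem norm_ad_le (had : ∀ T, ad T = χE ∘L T - T ∘L χS)
    (hF : ∀ T κ, F T κ = exp (κ • χE) ∘L T ∘L exp (κ • (-χS))) (T : S →L[ℂ] E) {κ₀ C : ℝ} (hκ₀ : 0 < κ₀)
    (hC : ∀ κ : ℂ, ‖κ‖ = κ₀ → ‖F T κ‖ ≤ C) : ‖ad T‖ ≤ C / κ₀ := by
  simpa using norm_iterate_ad_le had hF T 1 hκ₀ hC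

/-- `‖[χ,[χ,T]]‖ ≤ 2C∕κ₀²`. [folklore] (Cauchy's estimate) [cite: Balaban1985BackgroundPropagators, (3.101) p.414, (3.104) p.414] -/
theorem norm_ad_ad_le (had : ∀ T, ad T = χE ∘L T - T ∘L χS)
    (hF : ∀ T κ, F T κ = exp (κ • χE) ∘L T ∘L exp (κ • (-χS))) (T : S →L[ℂ] E) {κ₀ C : ℝ} (hκ₀ : 0 < κ₀)
    (hC : ∀ κ : ℂ, ‖κ‖ = κ₀ → ‖F T κ‖ ≤ C) : ‖ad (ad T)‖ ≤ 2 * C / κ₀ ^ 2 := by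
  simpa [Nat.factorial] using norm_iterate_ad_le had hF T 2 hκ₀ hC

/-- **THE `1∕M²`**: at the admissible radius `κ₀ = κ₁M∕g` (`κ₁` = decay rate, `M` = cutoff scale, `g = ‖∇χ₀‖_∞`) the double commutator obeys
`‖[χ,[χ,T]]‖ ≤ 2C·(g∕(κ₁M))²`. [folklore] (Cauchy's estimate) [cite: Balaban1985BackgroundPropagators, (3.101) p.414 «small factor O(M⁻¹)», (3.104) p.414] -/
theorem norm_ad_ad_le_of_radius (had : ∀ T, ad T = χE ∘L T - T ∘L χS)
    (hF : ∀ T κ, F T κ = exp (κ • χE) ∘L T ∘L exp (κ • (-χS))) (T : S →L[ℂ] E) {κ₁ M g C : ℝ}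
    (hκ₁ : 0 < κ₁) (hM : 0 < M) (hg : 0 < g)
    (hC : ∀ κ : ℂ, ‖κ‖ = κ₁ * M / g → ‖F T κ‖ ≤ C) :
    ‖ad (ad T)‖ ≤ 2 * C * (g / (κ₁ * M)) ^ 2 := by
  have h := norm_ad_ad_le had hF T (div_pos (mul_pos hκ₁ hM) hg) hC
  calc ‖ad (ad T)‖ ≤ 2 * C / (κ₁ * M / g) ^ 2 := h
    _ = 2 * C * (g / (κ₁ * M)) ^ 2 := by field_simp

/-- **LETTER-FREE FORM, single commutator**: `(∀ κ, ‖κ‖ = κ₀ → ‖e^{κχ_E} ∘ T ∘ e^{κ(−χ_S)}‖ ≤ C) ⇒ ‖χ_E ∘ T − T ∘ χ_S‖ ≤ C∕κ₀`. [folklore]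
(Cauchy's estimate) [cite: Balaban1985BackgroundPropagators, (3.101) p.414] -/
theorem norm_comm_le_of_circle_bound (χE : E →L[ℂ] E) (χS : S →L[ℂ] S) (T : S →L[ℂ] E) {κ₀ C : ℝ} (hκ₀ : 0 < κ₀)
    (hC : ∀ κ : ℂ, ‖κ‖ = κ₀ → ‖exp (κ • χE) ∘L T ∘L exp (κ • (-χS))‖ ≤ C) :
    ‖χE ∘L T - T ∘L χS‖ ≤ C / κ₀ :=
  norm_ad_le (ad := fun T => χE ∘L T - T ∘L χS) (F := fun T κ => exp (κ • χE) ∘L T ∘L exp (κ • (-χS)))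
    (fun _ => rfl) (fun _ _ => rfl) T hκ₀ hC

/-- **LETTER-FREE FORM, double commutator**: the same circle bound ⇒ `‖χ_E ∘ [χ,T] − [χ,T] ∘ χ_S‖ ≤ 2C∕κ₀²`. [folklore] (Cauchy's estimate)
[cite: Balaban1985BackgroundPropagators, (3.101) p.414, (3.104) p.414] -/
theorem norm_comm_comm_le_of_circle_bound (χE : E →L[ℂ] E) (χS : S →L[ℂ] S) (T : S →L[ℂ] E) {κ₀ C : ℝ} (hκ₀ : 0 < κ₀)
    (hC : ∀ κ : ℂ, ‖κ‖ = κ₀ → ‖exp (κ • χE) ∘L T ∘L exp (κ • (-χS))‖ ≤ C) :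
    ‖χE ∘L (χE ∘L T - T ∘L χS) - (χE ∘L T - T ∘L χS) ∘L χS‖ ≤ 2 * C / κ₀ ^ 2 :=
  norm_ad_ad_le (ad := fun T => χE ∘L T - T ∘L χS) (F := fun T κ => exp (κ • χE) ∘L T ∘L exp (κ • (-χS)))
    (fun _ => rfl) (fun _ _ => rfl) T hκ₀ hC

end Cauchy

/-! ## §2 Block decay from a conjugation bound (no analyticity) -/

section BlockScalar

variable {𝔸 : Type*} [NormedRing 𝔸] [NormedAlgebra ℂ 𝔸]

/-- `x·p = a•p ⇒ xⁿ·p = aⁿ•p`. [folklore] [cite: Balaban1985BackgroundPropagators, (3.49) p.399] -/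
theorem pow_mul_eq_smul_of_mul_eq_smul (x p : 𝔸) (a : ℂ) (h : x * p = a • p) (n : ℕ) :
    x ^ n * p = a ^ n • p := by
  induction n with
  | zero => simp
  | succ n ih => rw [pow_succ, mul_assoc, h, mul_smul_comm, ih, smul_smul, pow_succ']

/-- `q·x = b•q ⇒ q·xⁿ = bⁿ•q`. [folklore] [cite: Balaban1985BackgroundPropagators, (3.49) p.399] -/
theorem mul_pow_eq_smul_of_mul_eq_smul (q x : 𝔸) (b : ℂ) (h : q * x = b • q) (n : ℕ) :
    q * x ^ n = b ^ n • q := by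
  induction n with
  | zero => simp
  | succ n ih => rw [pow_succ', ← mul_assoc, h, smul_mul_assoc, ih, smul_smul, pow_succ']

variable [CompleteSpace 𝔸]

/-- `x·p = a•p ⇒ exp x · p = e^a • p` — termwise on the exponential SERIES (no spectral theory). [folklore]
[cite: Balaban1985BackgroundPropagators, (3.49) p.399] -/
theorem exp_mul_eq_smul_of_mul_eq_smul (x p : 𝔸) (a : ℂ) (h : x * p = a • p) :
    exp x * p = Complex.exp a • p := by
  have h1 : HasSum (fun n : ℕ => ((n.factorial⁻¹ : ℂ) • x ^ n) * p) (exp x * p) :=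
    (exp_series_hasSum_exp' (𝕂 := ℂ) x).mul_right p
  have h2 : HasSum (fun n : ℕ => ((n.factorial⁻¹ : ℂ) • a ^ n) • p) (Complex.exp a • p) := by
    have := (exp_series_hasSum_exp' (𝕂 := ℂ) a).smul_const p
    rwa [← congr_fun Complex.exp_eq_exp_ℂ a] at this
  have h3 : (fun n : ℕ => ((n.factorial⁻¹ : ℂ) • x ^ n) * p) = fun n : ℕ => ((n.factorial⁻¹ : ℂ) • a ^ n) • p := by
    funext n
    rw [smul_mul_assoc, pow_mul_eq_smul_of_mul_eq_smul x p a h n, smul_smul, smul_eq_mul]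
  rw [h3] at h1
  exact h1.unique h2

/-- `q·x = b•q ⇒ q · exp x = e^b • q`. [folklore] [cite: Balaban1985BackgroundPropagators, (3.49) p.399] -/
theorem mul_exp_eq_smul_of_mul_eq_smul (q x : 𝔸) (b : ℂ) (h : q * x = b • q) :
    q * exp x = Complex.exp b • q := by
  have h1 : HasSum (fun n : ℕ => q * ((n.factorial⁻¹ : ℂ) • x ^ n)) (q * exp x) :=
    (exp_series_hasSum_exp' (𝕂 := ℂ) x).mul_left q
  have h2 : HasSum (fun n : ℕ => ((n.factorial⁻¹ : ℂ) • b ^ n) • q) (Complex.exp b • q) := by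
    have := (exp_series_hasSum_exp' (𝕂 := ℂ) b).smul_const q
    rwa [← congr_fun Complex.exp_eq_exp_ℂ b] at this
  have h3 : (fun n : ℕ => q * ((n.factorial⁻¹ : ℂ) • x ^ n)) = fun n : ℕ => ((n.factorial⁻¹ : ℂ) • b ^ n) • q := by
    funext n
    rw [mul_smul_comm, mul_pow_eq_smul_of_mul_eq_smul q x b h n, smul_smul, smul_eq_mul]
  rw [h3] at h1
  exact h1.unique h2

end BlockScalar

section BlockDecay

variable {S E : Type*} [NormedAddCommGroup S] [NormedSpace ℂ S] [CompleteSpace S]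
  [NormedAddCommGroup E] [NormedSpace ℂ E] [CompleteSpace E]

/-- **THE EXACT BLOCK IDENTITY**: `χ_S ∘ p = a•p`, `q ∘ χ_E = b•q` ⇒ `q T p = e^{−κ(b−a)} • (q ∘ e^{κχ_E} T e^{κ(−χ_S)} ∘ p)`. [folklore]
(Combes–Thomas ∕ Agmon conjugation) [cite: Balaban1985BackgroundPropagators, (3.49) p.399, (3.101) p.414] -/
theorem block_eq_smul_block_conj (χE : E →L[ℂ] E) (χS : S →L[ℂ] S) (T : S →L[ℂ] E)
    (p : S →L[ℂ] S) (q : E →L[ℂ] E) (a b κ : ℂ) (hp : χS ∘L p = a • p) (hq : q ∘L χE = b • q) :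
    q ∘L T ∘L p = Complex.exp (-(κ * (b - a))) • (q ∘L (exp (κ • χE) ∘L T ∘L exp (κ • (-χS))) ∘L p) := by
  have hp' : exp (κ • (-χS)) * p = Complex.exp (-(κ * a)) • p := by
    refine exp_mul_eq_smul_of_mul_eq_smul _ _ _ ?_
    rw [smul_mul_assoc, neg_mul, mul_def, hp, smul_neg, smul_smul, neg_smul]
  have hq' : q * exp (κ • χE) = Complex.exp (κ * b) • q := by
    refine mul_exp_eq_smul_of_mul_eq_smul _ _ _ ?_
    rw [mul_smul_comm, mul_def, hq, smul_smul]
  have hpx : ∀ x, exp (κ • (-χS)) (p x) = Complex.exp (-(κ * a)) • p x := fun x => by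
    simpa [mul_def] using congrArg (fun f : S →L[ℂ] S => f x) hp'
  have hqy : ∀ y, q (exp (κ • χE) y) = Complex.exp (κ * b) • q y := fun y => by
    simpa [mul_def] using congrArg (fun f : E →L[ℂ] E => f y) hq'
  ext x
  simp only [comp_apply, smul_apply, hpx, map_smul, hqy, smul_smul]
  rw [← Complex.exp_add, ← Complex.exp_add, show -(κ * (b - a)) + (-(κ * a) + κ * b) = (0 : ℂ) by ring,
    Complex.exp_zero, one_smul]

/-- **BLOCK DECAY FROM ONE REAL CONJUGATION BOUND.** If the weight is the constant `a` on the source block and `b` on the target block, a bound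
`‖e^{κ₀χ_E} T e^{κ₀(−χ_S)}‖ ≤ C` at ONE real point `κ₀` gives `‖q T p‖ ≤ e^{−κ₀(b−a)}·‖q‖·C·‖p‖`. [folklore] (Combes–Thomas ∕ Agmon conjugation)
[cite: Balaban1985BackgroundPropagators, (3.49) p.399 «e^{−δ₀d(y,y′)}», (3.101) p.414] -/
theorem norm_block_le_of_conj_bound (χE : E →L[ℂ] E) (χS : S →L[ℂ] S) (T : S →L[ℂ] E)
    (p : S →L[ℂ] S) (q : E →L[ℂ] E) (a b κ₀ : ℝ) {C : ℝ}
    (hp : χS ∘L p = (a : ℂ) • p) (hq : q ∘L χE = (b : ℂ) • q) (hC : ‖exp ((κ₀ : ℂ) • χE) ∘L T ∘L exp ((κ₀ : ℂ) • (-χS))‖ ≤ C) :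
    ‖q ∘L T ∘L p‖ ≤ Real.exp (-(κ₀ * (b - a))) * (‖q‖ * C * ‖p‖) := by
  rw [block_eq_smul_block_conj χE χS T p q a b κ₀ hp hq, norm_smul]
  have he : ‖Complex.exp (-((κ₀ : ℂ) * (b - a)))‖ = Real.exp (-(κ₀ * (b - a))) := by
    rw [Complex.norm_exp]; simp
  rw [he]
  refine mul_le_mul_of_nonneg_left ?_ (Real.exp_pos _).le
  calc ‖q ∘L (exp ((κ₀ : ℂ) • χE) ∘L T ∘L exp ((κ₀ : ℂ) • (-χS))) ∘L p‖
      ≤ ‖q‖ * ‖(exp ((κ₀ : ℂ) • χE) ∘L T ∘L exp ((κ₀ : ℂ) • (-χS))) ∘L p‖ := opNorm_comp_le _ _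
    _ ≤ ‖q‖ * (‖exp ((κ₀ : ℂ) • χE) ∘L T ∘L exp ((κ₀ : ℂ) • (-χS))‖ * ‖p‖) := by gcongr; exact opNorm_comp_le _ _
    _ ≤ ‖q‖ * (C * ‖p‖) := by gcongr
    _ = ‖q‖ * C * ‖p‖ := by ring

/-- **TWO-SIDED BLOCK DECAY**: bounds at `κ₀` and `−κ₀` give `‖q T p‖ ≤ e^{−κ₀|b−a|}·‖q‖·C·‖p‖`. [folklore] (Combes–Thomas ∕ Agmon conjugation)
[cite: Balaban1985BackgroundPropagators, (3.49) p.399 «e^{−δ₀d(y,y′)}», (3.101) p.414] -/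
theorem norm_block_le_of_conj_bound_abs (χE : E →L[ℂ] E) (χS : S →L[ℂ] S) (T : S →L[ℂ] E)
    (p : S →L[ℂ] S) (q : E →L[ℂ] E) (a b κ₀ : ℝ) {C : ℝ}
    (hp : χS ∘L p = (a : ℂ) • p) (hq : q ∘L χE = (b : ℂ) • q)
    (hC : ‖exp ((κ₀ : ℂ) • χE) ∘L T ∘L exp ((κ₀ : ℂ) • (-χS))‖ ≤ C)
    (hC' : ‖exp (((-κ₀ : ℝ) : ℂ) • χE) ∘L T ∘L exp (((-κ₀ : ℝ) : ℂ) • (-χS))‖ ≤ C) :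
    ‖q ∘L T ∘L p‖ ≤ Real.exp (-(κ₀ * |b - a|)) * (‖q‖ * C * ‖p‖) := by
  rcases le_or_gt a b with hab | hab
  · rw [abs_of_nonneg (sub_nonneg.mpr hab)]
    exact norm_block_le_of_conj_bound χE χS T p q a b κ₀ hp hq hC
  · have h := norm_block_le_of_conj_bound χE χS T p q a b (-κ₀) hp hq hC'
    rw [abs_of_neg (sub_neg.mpr hab), show -(κ₀ * -(b - a)) = -(-κ₀ * (b - a)) by ring]
    exact h

end BlockDecay

/-! ## §3 Non-vacuity -/

section NonVacuity

variable {S E : Type*} [NormedAddCommGroup S] [NormedSpace ℂ S] [CompleteSpace S]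
  [NormedAddCommGroup E] [NormedSpace ℂ E] [CompleteSpace E]

/-- §1's letters with the ZERO weight: the family is constant, `C = ‖T‖` is admissible for every `κ₀ > 0`, and the conclusion reads `0 ≤ ‖T‖∕κ₀`.
[folklore] [cite: Balaban1985BackgroundPropagators, (3.101) p.414] -/
example (T : S →L[ℂ] E) {κ₀ : ℝ} (hκ₀ : 0 < κ₀) : ‖(0 : E →L[ℂ] E) ∘L T - T ∘L (0 : S →L[ℂ] S)‖ ≤ ‖T‖ / κ₀ :=
  norm_comm_le_of_circle_bound 0 0 T hκ₀ (fun κ _ => by simp [exp_zero, one_def])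

/-- §2's letters with the ZERO weight (`a = b = 0`), `p = q = 1`, `C = ‖T‖`: the conclusion reads `‖T‖ ≤ e⁰·‖1‖·‖T‖·‖1‖`-shaped and is met.
[folklore] [cite: Balaban1985BackgroundPropagators, (3.49) p.399] -/
example (T : S →L[ℂ] E) :
    ‖(1 : E →L[ℂ] E) ∘L T ∘L (1 : S →L[ℂ] S)‖ ≤ Real.exp (-(1 * ((0 : ℝ) - 0))) * (‖(1 : E →L[ℂ] E)‖ * ‖T‖ * ‖(1 : S →L[ℂ] S)‖) :=
  norm_block_le_of_conj_bound 0 0 T 1 1 0 0 1 (by simp) (by simp) (by simp [exp_zero, one_def])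

end NonVacuity

end Literature.MathematicalPhysics.QuantumFieldTheory.Balaban1983to89.B9Eq3101CommutatorCauchyBlockDecay
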